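import Literature.MathematicalPhysics.QuantumFieldTheory.Balaban1983to89.B12EuclCov567
import Literature.MathematicalPhysics.QuantumFieldTheory.Balaban1983to89.B12Schur433

/-!
# `Balaban1983to89.B12PolarizationTensor120` — [Balaban1987RG1] (1.20) p. 264: the vacuum polarization tensor
`Π^{ab}_{j+1,μν}(g_j, x, x′)` WITH BODY (the finite-volume Hessian kernel of `B ↦ 𝐄^{(j+1)}(g_j, U_{j+1}(exp iB))` at
`B = 0`), and the theorems that make it THE KERNEL OF THE HESSIAN

CITATION HEADER (lean-in-tree rule 2026-08-18).  T. Bałaban, *Renormalization group approach to lattice gauge field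
theories. I. Generation of effective actions in a small field approximation and a coupling constant renormalization in
four dimensions*, Commun. Math. Phys. **109** (1987) 249–301, doi:10.1007/bf01215223 [Balaban1987RG1] (cell paper B12;
held `paper:balaban1987-cmp109-rg-i-small-field`; PDF page = journal page − 248), §1 p. 264 [PDF 16], displays (1.20),
(1.21) and the sentences between them.  The page was read first-hand as an image by the author of this file (render
`run/shared/lean/pub/pub-balaban/b2b-balaban-ref1/pages/1987-cmp109-rg-I-small-field/…-p016-x2.png`, unit
`lit-balaban-r09` gen 41, row B12.Eq1.20 of `HOME/lit-balaban-r09/ROWS-B12.md`); inside quotation marks nothing is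
altered.
Statement-level skeleton of published theorems with citation tags; proofs where landed; nothing here is a claim about
the Yang–Mills mass gap.

STATEMENTS REPRODUCED (verbatim, p. 264).  *"Now we describe the most important expressions in (1.3), (1.6), the
β-functions β_{j+1}(g_j). They are determined by the functions 𝐄^{(j+1)}(g_j, U_{j+1}) in (1.6). Let us denote
𝐄^{(j+1)}(g_j, B) = 𝐄^{(j+1)}(g_j, U_{j+1}(exp iB)). We define*
  `Π^{ab}_{j+1,μν}(g_j, x, x′) = (δ²/(δB^a_μ(x)δB^b_ν(x′)) 𝐄^{(j+1)})(g_j, 0).`                                (1.20)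
*This is the vacuum polarization tensor of the theory defined by the j-th fluctuation field integral. We will analyze
this tensor thoroughly in Sect. 5; now we describe its basic properties necessary to formulate a definition of the
β-functions. The function 𝐄^{(j+1)} is gauge invariant, hence it is invariant with respect to global transformations
V → R(v)V, v ∈ G, or B → R(v)B. The function (1.20) can be considered as a function of μ, ν, x, x′, with values in the
tensor product 𝔤⊗𝔤, and these values are invariant with respect to the transformations R(v)⊗R(v), v ∈ G. This is
possible only if they are proportional to the identity matrix, i.e. to δ^{ab}. By the Euclidean invariance of 𝐄^{(j+1)}
the function (1.20) is Euclidean covariant. This implies*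
  `Π^{ab}_{j+1,μν}(g_j, x, x′) = δ^{ab} Π_{j+1,μν}(g_j, x − x′),   Π_{j+1}(g_j, rb, rb′) = Π_{j+1}(g_j, b, b′),`     (1.21)
*where Π_{j+1,μν}(g_j, x) is a real valued function, and r is a Euclidean rotation leaving the lattice T^{(j+1)}
invariant. Now we take a limit of these functions as T^{(j+1)} ↗ Z^d."*

DICTIONARY (print ↦ Lean; the lineage's own finite-volume spelling of `…B12Transl58` §2, `…B12EuclCov567` §2,
`…B12Ward59`, `…B12Schur433` §Lineage — this file NAMES the object those modules write out in full).
* the unit lattice `T^{(j+1)}` (a finite torus) ↦ a finite type `T` (an `AddCommGroup` where translations / rotations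
  are used); positive directions `μ, ν` ↦ a finite type `Λ`; the charge space `𝔤` ↦ a normed space `V`; a bond field
  `B`, `B^a_μ(x)` = the `a`-th component of `B(⟨x, x + e_μ⟩) ∈ 𝔤` ↦ `B : Λ → T → V`.
* `𝐄^{(j+1)}(g_j, B)` as a function of `B` ↦ an abstract `𝓔 : (Λ → T → V) → F` (§1–§4); print's concrete shape
  `B ↦ 𝐄^{(j+1)}(g_j, U_{j+1}(exp iB))` ↦ `expChart ℰ ρ := fun B => ℰ (fun ν x => exp (ρ (B ν x)))` (§5) with
  `ℰ := 𝐄^{(j+1)}(g_j, U_{j+1}(·))` read as ONE function of the unit-lattice configuration (the minimizer map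
  `U_{j+1}(·)` of [15] is ABSORBED into `ℰ`, not constructed — rows B12.Eq0.21 / B11) and `ρ : V →L[ℝ] 𝔄` the
  representation `A ↦ iA` of `𝔤` in the matrix algebra (the factor `i` absorbed, as in `…B12Semisimple414`).
* the variational derivative `δ/δB^a_μ(x)` ↦ the Fréchet derivative in the one-bond direction
  `Pi.single μ (Pi.single x v)` with colour direction `v ∈ V` (`v = T_a` a basis vector for the component `a`);
  (1.20) ↦ **`polTensor 𝕜 𝓔 μ x v ν y w`** `:= fderiv 𝕜 (fderiv 𝕜 𝓔) 0 (Pi.single μ (Pi.single x v)) (Pi.single ν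
  (Pi.single y w))` (= `Π_{μν}(x, y)` evaluated on `v ⊗ w ∈ 𝔤⊗𝔤, print's "values in the tensor product 𝔤⊗𝔤"), and its
  components in a basis `bV` of `V`, **`polComp 𝕜 𝓔 bV μ x a ν y b = Π^{ab}_{μν}(x, y)`**.

WHAT IS PROVED (kernel-checked; theorems only besides the definitions with bodies `polTensor`, `polComp`, `singleCLM`,
`polTensorL`, `globalCLM`, `expChart`; no `Prop`-valued fact, no `sorry`).
* §1 (1.20) IS THE KERNEL OF THE HESSIAN: bilinearity in the colour directions (`polTensor_add_left/right`,
  `polTensor_smul_left/right`, the bundled `polTensorL`), and **`hessian_apply_eq_sum_polTensor`**: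
  `D²𝓔(0)(u, w) = Σ_{μ,x} Σ_{ν,y} Π_{μν}(x, y)(u_μ(x) ⊗ w_ν(y))` for ALL fields `u, w` on the finite torus — the form in
  which print USES (1.20) ((4.1) p. 282, (4.34) p. 289, (5.1)/(5.43) pp. 292/297: `⟨(δ²/δB²)𝐄 B₁, B₂⟩ = Σ Π … B₁ B₂`);
  with a basis, **`hessian_apply_eq_sum_polComp`**: `D²𝓔(0)(u, w) = Σ_{μ,x,a} Σ_{ν,y,b} u^a_μ(x) w^b_ν(y) Π^{ab}_{μν}(x, y)`
  — the literal reading of (1.20) as the matrix of second partial derivatives `∂²/∂B^a_μ(x)∂B^b_ν(y)` at `0`.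
* §2 symmetry `Π_{μν}(x, y)(v ⊗ w) = Π_{νμ}(y, x)(w ⊗ v)` for `𝓔` of class `C²` at `0` over `ℝ`/`ℂ` (Schwarz;
  `…B12Transl58.hessian_swap`): `polTensor_swap`, `polComp_swap`.
* §3 the p. 264 sentence *"invariant with respect to global transformations … B → R(v)B … these values are invariant
  with respect to the transformations R(v)⊗R(v)"*: **`polTensor_global`** — if `𝓔(R∘B) = 𝓔(B)` for a continuous linear
  `R : V → V` (e.g. `R = Ad(v)`), then `Π_{μν}(x, y)(Rv ⊗ Rw) = Π_{μν}(x, y)(v ⊗ w)` (`…B12Covariance54.hessian_invariant`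
  applied to the field-space map `B ↦ R∘B`, built here as `globalCLM`).
* §4 (1.21)₂ *"Π(rb, rb′) = Π(b, b′)"* at finite volume for the named object, from the invariances of `𝓔`, BY NAME from
  the lineage: translations `polTensor_translate` (`…B12Transl58.hessian_translate_pi`), hence `polTensor_eq_sub_zero`
  (`Π_{μν}(x, y) = Π_{μν}(x − y, 0)`, the shape (1.21)₁ takes) and `eq121_polTensor` (= `…B12Transl58.eq121_finiteVolume`
  instantiated: translation invariance ∧ symmetry ∧ one-variable form ∧ `Π_{μν}(z) = Π_{νμ}(−z)`); axis permutations
  `polTensor_perm` and reflections `polTensor_refl` (`…B12EuclCov567.hessian_perm_pi` / `hessian_refl_pi`).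
* §5 print's chart: `expChart_zero` (`𝐄(g, B)|_{B=0} = 𝐄(g, 1)`), `contDiff_expChart`, `contDiffAt_expChart`,
  `polTensor_expChart_swap`; and **(1.21)₁ first line for the named object**, `exists_scalar_kernel_polTensor_expChart`:
  for `G` semisimple with scalar centroid (the hypotheses, verbatim, of `…B12Schur433.hessian_chart_eq_sum_scalar_kernel`:
  `𝐄` of class `C³` at `1` and gauge invariant (4.7) in the lineage's `h47` form), there is a SCALAR kernel `E_{μν}(x, y)`
  with `Π_{μν}(x, y)(a ⊗ b) = β(a, b) · E_{μν}(x, y)` for any nondegenerate invariant form `β` (print: `tr`, i.e. `δ^{ab}`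
  in an orthonormal basis) — *"proportional to the identity matrix, i.e. to δ^{ab}"*; Killing-form specialisation
  `exists_scalar_kernel_polTensor_expChart_killing`.

* §6 (v1.1, gen 41, APPEND-ONLY; §§1–5 byte-identical) the third structural property print lists for `Π`, the
  WARD IDENTITIES: p. 284 (4.15)₁ *"⟨(δ²/δB²)𝐄(1), B₁, ∂λ⟩ = 0"* and p. 293 (5.9) *"Σ_μ ∂*_μΠ_{μν}(x − y) = Σ_ν ∂_νΠ_{μν}(x − y)
  = 0"* AT FINITE VOLUME FOR THE NAMED OBJECT: `ward415_polTensor` (abstract `𝓔` under the lineage's `h415` hypothesis;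
  `…B12Ward59.ward415_finiteVolume` instantiated with `H := polTensor`), and `ward415_polTensor_expChart` for print's chart
  `B ↦ 𝐄(exp B)` (`V = 𝔄`, `ρ = id`) with `h415` DISCHARGED from the gauge invariance (4.7) (`h47`) and (4.14) `D𝐄(1) = 0` by
  `…B12GaugeInv47.h415_of_gaugeInvariance`.

HONEST SCOPE.  (i) Finite volume only: (1.20) is printed on the torus `T^{(j+1)}` and so is this file; the limit
`T^{(j+1)} ↗ Z^d` of (1.21) ("exists by the localized representation (1.7)") is the business of `…B12Limit51`,
`…B12WholeLattice290`, `…B12Transl58` §3 and is not touched.  (ii) `𝓔` is abstract: the composite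
`B ↦ 𝐄^{(j+1)}(g_j, U_{j+1}(exp iB))` through [15]'s background-field map is not constructed in the tree; `expChart`
records only the `exp iB` part.  (iii) The `g_j`-dependence of `Π` is a parameter of `𝓔` (one `𝓔` per `g_j`), cf.
`…B12BetaSmooth` for what print does and does not say about it.  (iv) The δ^{ab}-conclusion of §5 carries the lineage's
extra named hypothesis `hcen` (scalar centroid = `G` simple) exactly as `…B12Schur433` does; print says "semisimple".
-/

namespace Literature.MathematicalPhysics.QuantumFieldTheory.Balaban1983to89.B12PolarizationTensor120

open Literature.MathematicalPhysics.QuantumFieldTheory.Balaban1983to89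
open Literature.MathematicalPhysics.QuantumFieldTheory.Balaban1983to89.B12Covariance54 (hessian_invariant)
open Literature.MathematicalPhysics.QuantumFieldTheory.Balaban1983to89.B12Transl58 (apply_eq_apply_sub_zero
  hessian_swap hessian_translate_pi eq121_finiteVolume)
open Literature.MathematicalPhysics.QuantumFieldTheory.Balaban1983to89.B12EuclCov567 (hessian_perm_pi hessian_refl_pi)
open NormedSpace (exp)
open Filter
open _root_.Topology

/-! ## §1 The definition (1.20) and the Hessian as a sum over its kernel -/

section Def

variable (𝕜 : Type*) [NontriviallyNormedField 𝕜] {Λ T V F : Type*} [Fintype Λ] [Fintype T] [DecidableEq Λ]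
  [DecidableEq T] [NormedAddCommGroup V] [NormedSpace 𝕜 V] [NormedAddCommGroup F] [NormedSpace 𝕜 F]

/-- **(1.20), the vacuum polarization tensor at finite volume**: for `𝓔 = 𝐄^{(j+1)}(g_j, ·)` as a function of the bond
field `B : Λ → T → V` (print: *"Let us denote 𝐄^{(j+1)}(g_j, B) = 𝐄^{(j+1)}(g_j, U_{j+1}(exp iB))"*),
`polTensor 𝕜 𝓔 μ x v ν y w = (δ²𝓔/δB_μ(x)δB_ν(y))(0)` evaluated on the colour directions `v ⊗ w ∈ 𝔤⊗𝔤` — print's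
*"Π^{ab}_{j+1,μν}(g_j, x, x′) = (δ²/(δB^a_μ(x)δB^b_ν(x′)) 𝐄^{(j+1)})(g_j, 0)"* read *"as a function of μ, ν, x, x′, with
values in the tensor product 𝔤⊗𝔤"*; the components `Π^{ab}` are `polComp`.  The body is the lineage's finite-volume
Hessian expression (`…B12Transl58` §2). [cite: Balaban1987RG1, (1.20) p.264] -/
noncomputable def polTensor (𝓔 : (Λ → T → V) → F) (μ : Λ) (x : T) (v : V) (ν : Λ) (y : T) (w : V) : F :=
  fderiv 𝕜 (fderiv 𝕜 𝓔) 0 (Pi.single μ (Pi.single x v)) (Pi.single ν (Pi.single y w))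

omit [Fintype Λ] [Fintype T] in
/-- (1.20) unfolded: `Π_{μν}(x, y)(v ⊗ w) = D²𝓔(0)(δ_{μ,x}v, δ_{ν,y}w)`. [cite: Balaban1987RG1, (1.20) p.264] -/
theorem polTensor_def (𝓔 : (Λ → T → V) → F) (μ : Λ) (x : T) (v : V) (ν : Λ) (y : T) (w : V) :
    polTensor 𝕜 𝓔 μ x v ν y w =
      fderiv 𝕜 (fderiv 𝕜 𝓔) 0 (Pi.single μ (Pi.single x v)) (Pi.single ν (Pi.single y w)) := rfl

/-- **The components `Π^{ab}_{μν}(x, y)` of (1.20) in a basis `bV = (T_a)_a` of the charge space**: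
`polComp 𝕜 𝓔 bV μ x a ν y b = Π_{μν}(x, y)(T_a ⊗ T_b) = ∂²𝓔/∂B^a_μ(x)∂B^b_ν(y) (0)`. [cite: Balaban1987RG1, (1.20) p.264] -/
noncomputable def polComp {ι : Type*} (𝓔 : (Λ → T → V) → F) (bV : Module.Basis ι 𝕜 V) (μ : Λ) (x : T) (a : ι)
    (ν : Λ) (y : T) (b : ι) : F :=
  polTensor 𝕜 𝓔 μ x (bV a) ν y (bV b)

/-- The one-bond embedding `v ↦ δ_{μ,x}v` of a colour direction as a continuous linear map of the finite-volume field
space (the direction of the variational derivative `δ/δB_μ(x)`). [cite: Balaban1987RG1, (1.20) p.264] -/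
noncomputable def singleCLM (μ : Λ) (x : T) : V →L[𝕜] (Λ → T → V) :=
  (ContinuousLinearMap.single 𝕜 (fun _ : Λ => T → V) μ).comp (ContinuousLinearMap.single 𝕜 (fun _ : T => V) x)

omit [Fintype Λ] [Fintype T] in
/-- `singleCLM μ x v = δ_{μ,x}v`. [cite: Balaban1987RG1, (1.20) p.264] -/
@[simp] theorem singleCLM_apply (μ : Λ) (x : T) (v : V) :
    singleCLM 𝕜 μ x v = (Pi.single μ (Pi.single x v) : Λ → T → V) := rfl

/-- **(1.20) as a continuous bilinear map on the colour directions**: `Π_{μν}(x, y) ∈ L(V, L(V, F))` (print's value in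
`𝔤⊗𝔤`, dually). [cite: Balaban1987RG1, (1.20) p.264] -/
noncomputable def polTensorL (𝓔 : (Λ → T → V) → F) (μ : Λ) (x : T) (ν : Λ) (y : T) : V →L[𝕜] V →L[𝕜] F :=
  (fderiv 𝕜 (fderiv 𝕜 𝓔) 0).bilinearComp (singleCLM 𝕜 μ x) (singleCLM 𝕜 ν y)

/-- `polTensorL … v w = polTensor … v … w`. [cite: Balaban1987RG1, (1.20) p.264] -/
@[simp] theorem polTensorL_apply (𝓔 : (Λ → T → V) → F) (μ : Λ) (x : T) (ν : Λ) (y : T) (v w : V) :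
    polTensorL 𝕜 𝓔 μ x ν y v w = polTensor 𝕜 𝓔 μ x v ν y w := by
  simp [polTensorL, polTensor, ContinuousLinearMap.bilinearComp_apply]

/-- Additivity of (1.20) in the first colour direction. [cite: Balaban1987RG1, (1.20) p.264] -/
theorem polTensor_add_left (𝓔 : (Λ → T → V) → F) (μ : Λ) (x : T) (v v' : V) (ν : Λ) (y : T) (w : V) :
    polTensor 𝕜 𝓔 μ x (v + v') ν y w = polTensor 𝕜 𝓔 μ x v ν y w + polTensor 𝕜 𝓔 μ x v' ν y w := by
  rw [← polTensorL_apply, ← polTensorL_apply, ← polTensorL_apply, map_add, _root_.add_apply]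

/-- Additivity of (1.20) in the second colour direction. [cite: Balaban1987RG1, (1.20) p.264] -/
theorem polTensor_add_right (𝓔 : (Λ → T → V) → F) (μ : Λ) (x : T) (v : V) (ν : Λ) (y : T) (w w' : V) :
    polTensor 𝕜 𝓔 μ x v ν y (w + w') = polTensor 𝕜 𝓔 μ x v ν y w + polTensor 𝕜 𝓔 μ x v ν y w' := by
  rw [← polTensorL_apply, ← polTensorL_apply, ← polTensorL_apply, map_add]

/-- Homogeneity of (1.20) in the first colour direction. [cite: Balaban1987RG1, (1.20) p.264] -/
theorem polTensor_smul_left (𝓔 : (Λ → T → V) → F) (μ : Λ) (x : T) (c : 𝕜) (v : V) (ν : Λ) (y : T) (w : V) :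
    polTensor 𝕜 𝓔 μ x (c • v) ν y w = c • polTensor 𝕜 𝓔 μ x v ν y w := by
  rw [← polTensorL_apply, ← polTensorL_apply, map_smul, _root_.smul_apply]

/-- Homogeneity of (1.20) in the second colour direction. [cite: Balaban1987RG1, (1.20) p.264] -/
theorem polTensor_smul_right (𝓔 : (Λ → T → V) → F) (μ : Λ) (x : T) (v : V) (ν : Λ) (y : T) (c : 𝕜) (w : V) :
    polTensor 𝕜 𝓔 μ x v ν y (c • w) = c • polTensor 𝕜 𝓔 μ x v ν y w := by
  rw [← polTensorL_apply, ← polTensorL_apply, map_smul]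

/-- (1.20) vanishes on the zero colour direction (first slot). [cite: Balaban1987RG1, (1.20) p.264] -/
@[simp] theorem polTensor_zero_left (𝓔 : (Λ → T → V) → F) (μ : Λ) (x : T) (ν : Λ) (y : T) (w : V) :
    polTensor 𝕜 𝓔 μ x 0 ν y w = 0 := by
  rw [← polTensorL_apply, map_zero, _root_.zero_apply]

/-- (1.20) vanishes on the zero colour direction (second slot). [cite: Balaban1987RG1, (1.20) p.264] -/
@[simp] theorem polTensor_zero_right (𝓔 : (Λ → T → V) → F) (μ : Λ) (x : T) (v : V) (ν : Λ) (y : T) :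
    polTensor 𝕜 𝓔 μ x v ν y 0 = 0 := by
  rw [← polTensorL_apply, map_zero]

/-- Finite sums in the first colour direction. [cite: Balaban1987RG1, (1.20) p.264] -/
theorem polTensor_sum_left {ι : Type*} (s : Finset ι) (𝓔 : (Λ → T → V) → F) (μ : Λ) (x : T) (v : ι → V) (ν : Λ)
    (y : T) (w : V) :
    polTensor 𝕜 𝓔 μ x (∑ i ∈ s, v i) ν y w = ∑ i ∈ s, polTensor 𝕜 𝓔 μ x (v i) ν y w := by
  simp_rw [← polTensorL_apply]
  rw [map_sum, _root_.sum_apply]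

/-- Finite sums in the second colour direction. [cite: Balaban1987RG1, (1.20) p.264] -/
theorem polTensor_sum_right {ι : Type*} (s : Finset ι) (𝓔 : (Λ → T → V) → F) (μ : Λ) (x : T) (v : V) (ν : Λ)
    (y : T) (w : ι → V) :
    polTensor 𝕜 𝓔 μ x v ν y (∑ i ∈ s, w i) = ∑ i ∈ s, polTensor 𝕜 𝓔 μ x v ν y (w i) := by
  simp_rw [← polTensorL_apply]
  rw [map_sum]

/-- Every field on the finite torus is the sum of its one-bond pieces: `u = Σ_{μ,x} δ_{μ,x} u_μ(x)`. [folklore] -/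
private theorem sum_sum_single (u : Λ → T → V) :
    ∑ μ, ∑ x, (Pi.single μ (Pi.single x (u μ x)) : Λ → T → V) = u := by
  have h : ∀ μ, ∑ x, (Pi.single μ (Pi.single x (u μ x)) : Λ → T → V) = Pi.single μ (u μ) := fun μ => by
    have hs := (map_sum (AddMonoidHom.single (fun _ : Λ => T → V) μ) (fun x => Pi.single x (u μ x))
      Finset.univ).symm
    simp only [AddMonoidHom.single_apply] at hs
    rw [hs, Finset.univ_sum_single]
  simp_rw [h]
  exact Finset.univ_sum_single u

/-- **(1.20) is the kernel of the Hessian**: on the finite torus, for all bond fields `u, w`,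
`D²𝓔(0)(u, w) = Σ_{μ,x} Σ_{ν,y} Π_{μν}(x, y)(u_μ(x) ⊗ w_ν(y))` — the bilinear form `⟨(δ²/δB²)𝐄 u, w⟩` of (4.1) p. 282 /
(5.1) p. 292 written as the sum over its kernel (1.20) (print (4.34) p. 289: *"(4.6) = Σ_{(x,μ),(y,ν)} 𝐄^{(2)}_{μ,ν}(X, x, y)
…"*).  Pure bilinearity on a finite lattice. [cite: Balaban1987RG1, (1.20) p.264 with (4.1) p.282, (4.34) p.289] -/
theorem hessian_apply_eq_sum_polTensor (𝓔 : (Λ → T → V) → F) (u w : Λ → T → V) :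
    fderiv 𝕜 (fderiv 𝕜 𝓔) 0 u w = ∑ μ, ∑ x, ∑ ν, ∑ y, polTensor 𝕜 𝓔 μ x (u μ x) ν y (w ν y) := by
  conv_lhs => rw [← sum_sum_single u, ← sum_sum_single w]
  rw [map_sum (fderiv 𝕜 (fderiv 𝕜 𝓔) 0), _root_.sum_apply]
  refine Finset.sum_congr rfl fun μ _ => ?_
  rw [map_sum (fderiv 𝕜 (fderiv 𝕜 𝓔) 0), _root_.sum_apply]
  refine Finset.sum_congr rfl fun x _ => ?_
  rw [map_sum]
  refine Finset.sum_congr rfl fun ν _ => ?_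
  rw [map_sum]
  rfl

/-- **(1.20) in a basis**: `Π_{μν}(x, y)(v ⊗ w) = Σ_{a,b} v^a w^b Π^{ab}_{μν}(x, y)` with `v^a = bV.repr v a` the
coordinates of the colour directions. [cite: Balaban1987RG1, (1.20) p.264] -/
theorem polTensor_eq_sum_polComp {ι : Type*} [Fintype ι] (bV : Module.Basis ι 𝕜 V) (𝓔 : (Λ → T → V) → F) (μ : Λ)
    (x : T) (v : V) (ν : Λ) (y : T) (w : V) :
    polTensor 𝕜 𝓔 μ x v ν y w = ∑ a, ∑ b, (bV.repr v a * bV.repr w b) • polComp 𝕜 𝓔 bV μ x a ν y b := by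
  conv_lhs => rw [← bV.sum_repr v, ← bV.sum_repr w]
  rw [polTensor_sum_left]
  refine Finset.sum_congr rfl fun a _ => ?_
  rw [polTensor_smul_left, polTensor_sum_right, Finset.smul_sum]
  refine Finset.sum_congr rfl fun b _ => ?_
  rw [polTensor_smul_right, smul_smul, polComp]

/-- **The literal reading of (1.20) as a matrix of second partial derivatives**: on the finite torus, with a basis of the
charge space, `D²𝓔(0)(u, w) = Σ_{μ,x} Σ_{ν,y} Σ_{a,b} u^a_μ(x) w^b_ν(y) Π^{ab}_{μν}(x, y)` for all fields `u, w`.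
[cite: Balaban1987RG1, (1.20) p.264 with (4.34) p.289] -/
theorem hessian_apply_eq_sum_polComp {ι : Type*} [Fintype ι] (bV : Module.Basis ι 𝕜 V) (𝓔 : (Λ → T → V) → F)
    (u w : Λ → T → V) :
    fderiv 𝕜 (fderiv 𝕜 𝓔) 0 u w =
      ∑ μ, ∑ x, ∑ ν, ∑ y, ∑ a, ∑ b, (bV.repr (u μ x) a * bV.repr (w ν y) b) • polComp 𝕜 𝓔 bV μ x a ν y b := by
  rw [hessian_apply_eq_sum_polTensor]
  simp_rw [polTensor_eq_sum_polComp 𝕜 bV 𝓔]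

end Def

/-! ## §2 Symmetry of (1.20) (Schwarz) -/

section Symm

variable (𝕜 : Type*) [NontriviallyNormedField 𝕜] [IsRCLikeNormedField 𝕜] {Λ T V F : Type*} [Fintype Λ] [Fintype T]
  [DecidableEq Λ] [DecidableEq T] [NormedAddCommGroup V] [NormedSpace 𝕜 V] [NormedAddCommGroup F] [NormedSpace 𝕜 F]

/-- **(1.20) is symmetric**: `Π_{μν}(x, y)(v ⊗ w) = Π_{νμ}(y, x)(w ⊗ v)` for `𝓔` of class `C²` at `0` (over `ℝ` or `ℂ`;
Schwarz, the lineage's `…B12Transl58.hessian_swap`) — the word *"symmetric"* of (5.8) p. 293 for the named object.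
[cite: Balaban1987RG1, (1.20) p.264 with (5.8) p.293] -/
theorem polTensor_swap {𝓔 : (Λ → T → V) → F} (h𝓔 : ContDiffAt 𝕜 2 𝓔 0) (μ : Λ) (x : T) (v : V) (ν : Λ) (y : T)
    (w : V) : polTensor 𝕜 𝓔 μ x v ν y w = polTensor 𝕜 𝓔 ν y w μ x v :=
  hessian_swap h𝓔 _ _

/-- Symmetry of the components: `Π^{ab}_{μν}(x, y) = Π^{ba}_{νμ}(y, x)`. [cite: Balaban1987RG1, (1.20) p.264 with (5.8) p.293] -/
theorem polComp_swap {ι : Type*} (bV : Module.Basis ι 𝕜 V) {𝓔 : (Λ → T → V) → F} (h𝓔 : ContDiffAt 𝕜 2 𝓔 0)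
    (μ : Λ) (x : T) (a : ι) (ν : Λ) (y : T) (b : ι) :
    polComp 𝕜 𝓔 bV μ x a ν y b = polComp 𝕜 𝓔 bV ν y b μ x a :=
  polTensor_swap 𝕜 h𝓔 _ _ _ _ _ _

end Symm

/-! ## §3 The global gauge sentence of p. 264: invariance of `𝓔` under `B ↦ R(v)B` ⇒ invariance of (1.20) under
`R(v)⊗R(v)` -/

section Global

variable (𝕜 : Type*) [NontriviallyNormedField 𝕜] {Λ T V F : Type*} [NormedAddCommGroup V] [NormedSpace 𝕜 V]
  [NormedAddCommGroup F] [NormedSpace 𝕜 F]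

/-- **The global transformation `B ↦ R(v)B` as a continuous linear map of the field space** (print: *"global
transformations V → R(v)V, v ∈ G, or B → R(v)B"*; here `R` is any continuous linear map of the charge space, e.g. the
adjoint action `Ad(v)`): `(globalCLM R B)_μ(y) = R (B_μ(y))`. [cite: Balaban1987RG1, p.264 (after (1.20))] -/
def globalCLM (R : V →L[𝕜] V) : (Λ → T → V) →L[𝕜] (Λ → T → V) where
  toFun B μ y := R (B μ y)
  map_add' B B' := funext fun μ => funext fun y => by
    show R (B μ y + B' μ y) = R (B μ y) + R (B' μ y)
    rw [map_add]
  map_smul' c B := funext fun μ => funext fun y => by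
    show R (c • B μ y) = c • R (B μ y)
    rw [map_smul]
  cont := continuous_pi fun μ => continuous_pi fun y =>
    R.continuous.comp ((continuous_apply y).comp (continuous_apply μ))

/-- `(globalCLM R B)_μ(y) = R (B_μ(y))`. [cite: Balaban1987RG1, p.264 (after (1.20))] -/
@[simp] theorem globalCLM_apply (R : V →L[𝕜] V) (B : Λ → T → V) (μ : Λ) (y : T) :
    globalCLM 𝕜 R B μ y = R (B μ y) := rfl

variable [Fintype Λ] [Fintype T] [DecidableEq Λ] [DecidableEq T]

omit [Fintype Λ] [Fintype T] in
/-- A global transformation maps one-bond fields to one-bond fields: `R∘(δ_{μ,x}v) = δ_{μ,x}(Rv)`.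
[cite: Balaban1987RG1, p.264 (after (1.20))] -/
theorem globalCLM_single (R : V →L[𝕜] V) (μ : Λ) (x : T) (v : V) :
    globalCLM 𝕜 R (Pi.single μ (Pi.single x v) : Λ → T → V) = Pi.single μ (Pi.single x (R v)) := by
  funext κ z
  rw [globalCLM_apply]
  by_cases hκ : κ = μ
  · subst hκ
    by_cases hz : z = x
    · subst hz
      simp
    · simp [hz]
  · simp [hκ]

/-- **p. 264, the global gauge sentence**: *"The function 𝐄^{(j+1)} is gauge invariant, hence it is invariant with
respect to global transformations V → R(v)V, v ∈ G, or B → R(v)B. The function (1.20) … values are invariant with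
respect to the transformations R(v)⊗R(v), v ∈ G."* — if `𝓔(R∘B) = 𝓔(B)` for all `B` and `𝓔 ∈ C²`, then
`Π_{μν}(x, y)(Rv ⊗ Rw) = Π_{μν}(x, y)(v ⊗ w)` (`…B12Covariance54.hessian_invariant` for the map `globalCLM R`).
[cite: Balaban1987RG1, p.264 (after (1.20))] -/
theorem polTensor_global {𝓔 : (Λ → T → V) → F} (h𝓔 : ContDiff 𝕜 2 𝓔) (R : V →L[𝕜] V)
    (hinv : ∀ B : Λ → T → V, 𝓔 (fun μ y => R (B μ y)) = 𝓔 B) (μ : Λ) (x : T) (v : V) (ν : Λ) (y : T) (w : V) :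
    polTensor 𝕜 𝓔 μ x (R v) ν y (R w) = polTensor 𝕜 𝓔 μ x v ν y w := by
  have hinv' : 𝓔 ∘ (globalCLM 𝕜 R : (Λ → T → V) →L[𝕜] (Λ → T → V)) = 𝓔 := funext fun B => hinv B
  rw [polTensor_def, polTensor_def, ← globalCLM_single 𝕜 R μ x v, ← globalCLM_single 𝕜 R ν y w]
  exact hessian_invariant h𝓔 _ hinv' _ _

/-- The same for the components, with `R` read in the basis: `Σ_{a′b′} R_{a′a} R_{b′b} Π^{a′b′} = Π^{ab}`, stated as
`Π(R T_a ⊗ R T_b) = Π^{ab}`. [cite: Balaban1987RG1, p.264 (after (1.20))] -/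
theorem polComp_global {ι : Type*} (bV : Module.Basis ι 𝕜 V) {𝓔 : (Λ → T → V) → F} (h𝓔 : ContDiff 𝕜 2 𝓔)
    (R : V →L[𝕜] V) (hinv : ∀ B : Λ → T → V, 𝓔 (fun μ y => R (B μ y)) = 𝓔 B) (μ : Λ) (x : T) (a : ι) (ν : Λ)
    (y : T) (b : ι) :
    polTensor 𝕜 𝓔 μ x (R (bV a)) ν y (R (bV b)) = polComp 𝕜 𝓔 bV μ x a ν y b :=
  polTensor_global 𝕜 h𝓔 R hinv _ _ _ _ _ _

end Global

/-! ## §4 (1.21)₂ at finite volume for the named object: Euclidean covariance from the invariances of `𝓔` -/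

section Euclid

variable (𝕜 : Type*) [NontriviallyNormedField 𝕜] {Λ T V F : Type*} [Fintype Λ] [Fintype T] [DecidableEq Λ]
  [DecidableEq T] [NormedAddCommGroup V] [NormedSpace 𝕜 V] [NormedAddCommGroup F] [NormedSpace 𝕜 F]

/-- **(1.21)₂ for a translation `r = τ_a` of the torus**: if `𝓔(τ_a B) = 𝓔(B)` for all `a` ((5.2)/(5.3) p. 292) and
`𝓔 ∈ C²`, then `Π_{μν}(x + a, y + a) = Π_{μν}(x, y)` (`…B12Transl58.hessian_translate_pi` for the named object).
[cite: Balaban1987RG1, (1.21) p.264 with (5.2)-(5.4) p.292] -/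
theorem polTensor_translate [AddCommGroup T] {𝓔 : (Λ → T → V) → F} (h𝓔 : ContDiff 𝕜 2 𝓔)
    (hinv : ∀ (a : T) (B : Λ → T → V), 𝓔 (fun μ y => B μ (y - a)) = 𝓔 B) (μ : Λ) (x : T) (v : V) (ν : Λ) (y : T)
    (w : V) (a : T) : polTensor 𝕜 𝓔 μ (x + a) v ν (y + a) w = polTensor 𝕜 𝓔 μ x v ν y w :=
  hessian_translate_pi h𝓔 hinv μ ν a x y v w

/-- **The one-variable shape of (1.21)₁ at finite volume**: under translation invariance `Π_{μν}(x, y) = Π_{μν}(x − y, 0)`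
(print: *"Π^{ab}_{j+1,μν}(g_j, x, x′) = δ^{ab} Π_{j+1,μν}(g_j, x − x′)"* — the `x − x′` dependence;
`…B12Transl58.apply_eq_apply_sub_zero`). [cite: Balaban1987RG1, (1.21) p.264] -/
theorem polTensor_eq_sub_zero [AddCommGroup T] {𝓔 : (Λ → T → V) → F} (h𝓔 : ContDiff 𝕜 2 𝓔)
    (hinv : ∀ (a : T) (B : Λ → T → V), 𝓔 (fun μ y => B μ (y - a)) = 𝓔 B) (μ : Λ) (x : T) (v : V) (ν : Λ) (y : T)
    (w : V) : polTensor 𝕜 𝓔 μ x v ν y w = polTensor 𝕜 𝓔 μ (x - y) v ν 0 w :=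
  apply_eq_apply_sub_zero (P := fun x y => polTensor 𝕜 𝓔 μ x v ν y w)
    (fun a x y => polTensor_translate 𝕜 h𝓔 hinv μ x v ν y w a) x y

/-- **(1.21) at finite volume, the lineage's package for the named object** (`…B12Transl58.eq121_finiteVolume` with
`H_{μν}(x, y) := Π_{μν}(x, y)(v ⊗ v)`): for `𝕜 = ℝ` or `ℂ`, `𝓔 ∈ C²` translation invariant ⇒ `Π` is translation
invariant, symmetric, a function of `x − y`, and `Π_{μν}(z, 0) = Π_{νμ}(−z, 0)` ((5.8) p. 293).
[cite: Balaban1987RG1, (1.20)-(1.21) p.264 with (5.8) p.293] -/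
theorem eq121_polTensor [IsRCLikeNormedField 𝕜] [AddCommGroup T] {𝓔 : (Λ → T → V) → F} (h𝓔 : ContDiff 𝕜 2 𝓔)
    (hinv : ∀ (a : T) (B : Λ → T → V), 𝓔 (fun μ y => B μ (y - a)) = 𝓔 B) (v : V) :
    (∀ μ ν a x y, polTensor 𝕜 𝓔 μ (x + a) v ν (y + a) v = polTensor 𝕜 𝓔 μ x v ν y v) ∧
      (∀ μ ν x y, polTensor 𝕜 𝓔 μ x v ν y v = polTensor 𝕜 𝓔 ν y v μ x v) ∧
      (∀ μ ν x y, polTensor 𝕜 𝓔 μ x v ν y v = polTensor 𝕜 𝓔 μ (x - y) v ν 0 v) ∧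
      ∀ μ ν z, polTensor 𝕜 𝓔 μ z v ν 0 v = polTensor 𝕜 𝓔 ν (-z) v μ 0 v :=
  eq121_finiteVolume h𝓔 hinv v (H := fun μ ν x y => polTensor 𝕜 𝓔 μ x v ν y v) fun _ _ _ _ => rfl

/-- **(1.21)₂ for an axis permutation** `r = r_π` acting by (5.3) (`(r_πB)_ν(y) = B_{π⁻¹ν}(r_π⁻¹y)`): invariance of
`𝓔` ⇒ `Π_{πμ,πν}(r x, r y) = Π_{μν}(x, y)` ((5.6) p. 292; `…B12EuclCov567.hessian_perm_pi` for the named object).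
[cite: Balaban1987RG1, (1.21) p.264 with (5.6) p.292] -/
theorem polTensor_perm {𝓔 : (Λ → T → V) → F} (h𝓔 : ContDiff 𝕜 2 𝓔) (σ : Equiv.Perm Λ) (r : T ≃ T)
    (hinv : ∀ B : Λ → T → V, 𝓔 (fun ν y => B (σ.symm ν) (r.symm y)) = 𝓔 B) (μ : Λ) (x : T) (v : V) (ν : Λ)
    (y : T) (w : V) : polTensor 𝕜 𝓔 (σ μ) (r x) v (σ ν) (r y) w = polTensor 𝕜 𝓔 μ x v ν y w :=
  hessian_perm_pi h𝓔 σ r hinv μ ν x y v w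

/-- **(1.21)₂ for a reflection** acting by (5.3) with the bond-reversal signs `ε_ν` and site maps `t_ν`
(`(εB)_ν(y) = ε_ν B_ν(t_ν y)`): invariance of `𝓔` ⇒ `Π_{μν}(t_μ x, t_ν y) = ε_με_ν Π_{μν}(x, y)` ((5.7) p. 293;
`…B12EuclCov567.hessian_refl_pi` for the named object). [cite: Balaban1987RG1, (1.21) p.264 with (5.7) p.293] -/
theorem polTensor_refl {𝓔 : (Λ → T → V) → F} (h𝓔 : ContDiff 𝕜 2 𝓔) (ε : Λ → 𝕜) (t : Λ → T ≃ T)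
    (hinv : ∀ B : Λ → T → V, 𝓔 (fun ν y => ε ν • B ν (t ν y)) = 𝓔 B) (μ : Λ) (x : T) (v : V) (ν : Λ) (y : T)
    (w : V) : polTensor 𝕜 𝓔 μ (t μ x) v ν (t ν y) w = (ε μ * ε ν) • polTensor 𝕜 𝓔 μ x v ν y w :=
  hessian_refl_pi h𝓔 ε t hinv μ ν x y v w

end Euclid

/-! ## §5 Print's chart `B ↦ 𝐄^{(j+1)}(g_j, U_{j+1}(exp iB))` and the δ^{ab}-structure (1.21)₁ of the named object -/

section Chart

variable {𝔄 : Type*} [NormedRing 𝔄] [NormedAlgebra ℝ 𝔄] [CompleteSpace 𝔄] {Λ T V F : Type*} [Fintype Λ] [Fintype T]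
  [NormedAddCommGroup V] [NormedSpace ℝ V] [NormedAddCommGroup F] [NormedSpace ℝ F]

/-- **Print's `𝐄^{(j+1)}(g_j, B)`** (*"Let us denote 𝐄^{(j+1)}(g_j, B) = 𝐄^{(j+1)}(g_j, U_{j+1}(exp iB))"*): the chart
`B ↦ ℰ((exp ρB_ν(x))_{ν,x})` of a functional `ℰ` of group-valued unit-lattice configurations (`ℰ := 𝐄^{(j+1)}(g_j,
U_{j+1}(·))`, the background-field map absorbed), `ρ : 𝔤 → 𝔄` the representation `A ↦ iA` — the lineage's chart of
`…B12Semisimple414` / `…B12Schur433`, named. [cite: Balaban1987RG1, p.264 (before (1.20))] -/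
noncomputable def expChart (ℰ : (Λ → T → 𝔄) → F) (ρ : V →L[ℝ] 𝔄) : (Λ → T → V) → F :=
  fun B => ℰ (fun ν x => exp (ρ (B ν x)))

omit [CompleteSpace 𝔄] [Fintype Λ] [Fintype T] [NormedAddCommGroup F] [NormedSpace ℝ F] in
/-- `expChart ℰ ρ B = ℰ(exp ρB)`. [cite: Balaban1987RG1, p.264 (before (1.20))] -/
theorem expChart_apply (ℰ : (Λ → T → 𝔄) → F) (ρ : V →L[ℝ] 𝔄) (B : Λ → T → V) :
    expChart ℰ ρ B = ℰ (fun ν x => exp (ρ (B ν x))) := rfl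

omit [CompleteSpace 𝔄] [Fintype Λ] [Fintype T] [NormedAddCommGroup F] [NormedSpace ℝ F] in
/-- At `B = 0` the chart sits at the configuration `1`: `𝐄^{(j+1)}(g_j, B)|_{B=0} = 𝐄^{(j+1)}(g_j, U_{j+1}(1))`
(`exp i0 = 1`; `…B12Semisimple414.chart_zero`). [cite: Balaban1987RG1, (1.20) p.264] -/
theorem expChart_zero (ℰ : (Λ → T → 𝔄) → F) (ρ : V →L[ℝ] 𝔄) : expChart ℰ ρ (0 : Λ → T → V) = ℰ 1 := by
  rw [expChart_apply, B12Semisimple414.chart_zero ρ]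

/-- The chart `B ↦ 𝐄^{(j+1)}(g_j, U_{j+1}(exp iB))` is `Cⁿ` when `ℰ` is (print differentiates it twice in (1.20); p. 261
*"E^{(j)} … analytic function"* (1.9); `…B12Semisimple414.contDiff_comp_chart`). [cite: Balaban1987RG1, p.264 (before (1.20)) with (1.9) p.261] -/
theorem contDiff_expChart {ℰ : (Λ → T → 𝔄) → F} (ρ : V →L[ℝ] 𝔄) {n : WithTop ℕ∞} (hℰ : ContDiff ℝ n ℰ) :
    ContDiff ℝ n (expChart ℰ ρ : (Λ → T → V) → F) :=
  B12Semisimple414.contDiff_comp_chart ρ hℰ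

/-- The chart `B ↦ 𝐄^{(j+1)}(g_j, U_{j+1}(exp iB))` is `Cⁿ` at `B = 0` when `ℰ` is `Cⁿ` at the configuration `1` (the
regularity (1.20) uses at `B = 0`). [cite: Balaban1987RG1, p.264 (before (1.20)) with (1.9) p.261] -/
theorem contDiffAt_expChart {ℰ : (Λ → T → 𝔄) → F} (ρ : V →L[ℝ] 𝔄) {n : WithTop ℕ∞} (hℰ : ContDiffAt ℝ n ℰ 1) :
    ContDiffAt ℝ n (expChart ℰ ρ : (Λ → T → V) → F) 0 := by
  have hC := B12Semisimple414.contDiff_chart (Λ := Λ) (T := T) ρ (n := n)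
  have h0 : (fun B : Λ → T → V => fun ν x => exp (ρ (B ν x))) 0 = 1 := B12Semisimple414.chart_zero ρ
  have hℰ' : ContDiffAt ℝ n ℰ ((fun B : Λ → T → V => fun ν x => exp (ρ (B ν x))) 0) := by
    rw [h0]
    exact hℰ
  exact hℰ'.comp 0 hC.contDiffAt

variable [DecidableEq Λ] [DecidableEq T]

/-- (1.20) of the chart is symmetric as soon as `𝐄` is `C²` at `1`: `Π_{μν}(x, y)(v ⊗ w) = Π_{νμ}(y, x)(w ⊗ v)`.
[cite: Balaban1987RG1, (1.20) p.264 with (5.8) p.293] -/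
theorem polTensor_expChart_swap {ℰ : (Λ → T → 𝔄) → F} (ρ : V →L[ℝ] 𝔄) (hℰ : ContDiffAt ℝ 2 ℰ 1) (μ : Λ) (x : T)
    (v : V) (ν : Λ) (y : T) (w : V) :
    polTensor ℝ (expChart ℰ ρ) μ x v ν y w = polTensor ℝ (expChart ℰ ρ) ν y w μ x v :=
  polTensor_swap ℝ (contDiffAt_expChart ρ hℰ) μ x v ν y w

omit [Fintype Λ] [Fintype T] [NormedSpace ℝ V] in
/-- Values of a one-bond field: `(δ_{μ,x}a)_{μ′}(x′) = a` if `(μ′, x′) = (μ, x)` and `0` otherwise. [folklore] -/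
private theorem single_single_apply (μ μ' : Λ) (x x' : T) (a : V) :
    (Pi.single μ (Pi.single x a) : Λ → T → V) μ' x' = if μ' = μ ∧ x' = x then a else 0 := by
  by_cases hμ : μ' = μ
  · subst hμ
    by_cases hx : x' = x
    · subst hx
      simp
    · simp [hx]
  · simp [hμ]

variable [AddCommGroup T] {𝔤 : Type*} [LieRing 𝔤] [LieAlgebra ℝ 𝔤] [FiniteDimensional ℝ 𝔤]

/-- **(1.21)₁, first line, for the named object — *"these values are invariant with respect to the transformations
R(v)⊗R(v), v ∈ G. This is possible only if they are proportional to the identity matrix, i.e. to δ^{ab}"***: under the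
hypotheses of the lineage's `…B12Schur433.hessian_chart_eq_sum_scalar_kernel` VERBATIM (`𝐄` of class `C³` at `1`; gauge
invariance (4.7) in the `h47` form; `ρ` a representation of `𝔤` read through `eV : V ≃ 𝔤`; `G` semisimple AND with scalar
centroid `hcen` — the lineage's located extra hypothesis, = `G` simple; `β` any nondegenerate invariant form, print's
`tr`), there is a SCALAR kernel `E_{μν}(x, y)` with `Π_{μν}(x, y)(a ⊗ b) = β(a, b) · E_{μν}(x, y)` for the tensor (1.20) of
the chart `B ↦ 𝐄(exp ρB)` — i.e. `Π^{ab} = δ^{ab} Π` in a `β`-orthonormal basis.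
[cite: Balaban1987RG1, (1.20)-(1.21) p.264 with (4.32)-(4.34) p.289] -/
theorem exists_scalar_kernel_polTensor_expChart [LieAlgebra.IsSemisimple ℝ 𝔤] (eV : V ≃ₗ[ℝ] 𝔤)
    {ℰ : (Λ → T → 𝔄) → F} (e : Λ → T) (ρ : V →L[ℝ] 𝔄)
    (hρ : ∀ a b : V, ρ (eV.symm ⁅eV a, eV b⁆) = ρ a * ρ b - ρ b * ρ a) (hℰ : ContDiffAt ℝ 3 ℰ 1)
    (h47 : ∀ lam : T → V, ∀ᶠ W in 𝓝 (1 : Λ → T → 𝔄), ∀ᶠ t in 𝓝 (0 : ℝ),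
      ℰ (fun ν x => exp (t • ρ (lam x)) * W ν x * exp (-(t • ρ (lam (x + e ν))))) = ℰ W)
    (β : LinearMap.BilinForm ℝ 𝔤) (hβ : β.lieInvariant 𝔤) (hβn : β.Nondegenerate)
    (hcen : ∀ φ : 𝔤 →ₗ[ℝ] 𝔤, (∀ x y : 𝔤, φ ⁅x, y⁆ = ⁅x, φ y⁆) → ∃ c : ℝ, ∀ x, φ x = c • x) :
    ∃ E : Λ → T → Λ → T → F, ∀ (μ : Λ) (x : T) (a : V) (ν : Λ) (y : T) (b : V),
      polTensor ℝ (expChart ℰ ρ) μ x a ν y b = β (eV a) (eV b) • E μ x ν y := by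
  obtain ⟨E, hE⟩ := B12Schur433.hessian_chart_eq_sum_scalar_kernel eV e ρ hρ hℰ h47 β hβ hβn hcen
  refine ⟨E, fun μ x a ν y b => ?_⟩
  have key : ∀ μ' x' ν' y', (μ' ≠ μ ∨ x' ≠ x ∨ ν' ≠ ν ∨ y' ≠ y) →
      β (eV ((Pi.single μ (Pi.single x a) : Λ → T → V) μ' x'))
          (eV ((Pi.single ν (Pi.single y b) : Λ → T → V) ν' y')) • E μ' x' ν' y' = 0 := by
    intro μ' x' ν' y' hne
    rcases hne with h | h | h | h
    · simp [single_single_apply, h]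
    · simp [single_single_apply, h]
    · simp [single_single_apply, h]
    · simp [single_single_apply, h]
  have h := hE (Pi.single μ (Pi.single x a)) (Pi.single ν (Pi.single y b))
  rw [polTensor_def, show (expChart ℰ ρ : (Λ → T → V) → F) = fun B => ℰ (fun ν x => exp (ρ (B ν x))) from rfl, h]
  rw [Finset.sum_eq_single μ (fun μ' _ hμ' => Finset.sum_eq_zero fun x' _ => Finset.sum_eq_zero fun ν' _ =>
    Finset.sum_eq_zero fun y' _ => key _ _ _ _ (Or.inl hμ')) (by simp)]
  rw [Finset.sum_eq_single x (fun x' _ hx' => Finset.sum_eq_zero fun ν' _ => Finset.sum_eq_zero fun y' _ =>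
    key _ _ _ _ (Or.inr (Or.inl hx'))) (by simp)]
  rw [Finset.sum_eq_single ν (fun ν' _ hν' => Finset.sum_eq_zero fun y' _ => key _ _ _ _ (Or.inr (Or.inr (Or.inl hν'))))
    (by simp)]
  rw [Finset.sum_eq_single y (fun y' _ hy' => key _ _ _ _ (Or.inr (Or.inr (Or.inr hy')))) (by simp)]
  simp [single_single_apply]

/-- The same with the Killing form (`G` semisimple, `𝔤` Killing: `β = κ`): `Π_{μν}(x, y)(a ⊗ b) = κ(a, b) · E_{μν}(x, y)`
(`…B12Schur433.hessian_chart_eq_sum_scalar_kernel_killing`). [cite: Balaban1987RG1, (1.20)-(1.21) p.264 with (4.32)-(4.34) p.289] -/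
theorem exists_scalar_kernel_polTensor_expChart_killing [LieAlgebra.IsKilling ℝ 𝔤] (eV : V ≃ₗ[ℝ] 𝔤)
    {ℰ : (Λ → T → 𝔄) → F} (e : Λ → T) (ρ : V →L[ℝ] 𝔄)
    (hρ : ∀ a b : V, ρ (eV.symm ⁅eV a, eV b⁆) = ρ a * ρ b - ρ b * ρ a) (hℰ : ContDiffAt ℝ 3 ℰ 1)
    (h47 : ∀ lam : T → V, ∀ᶠ W in 𝓝 (1 : Λ → T → 𝔄), ∀ᶠ t in 𝓝 (0 : ℝ),
      ℰ (fun ν x => exp (t • ρ (lam x)) * W ν x * exp (-(t • ρ (lam (x + e ν))))) = ℰ W)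
    (hcen : ∀ φ : 𝔤 →ₗ[ℝ] 𝔤, (∀ x y : 𝔤, φ ⁅x, y⁆ = ⁅x, φ y⁆) → ∃ c : ℝ, ∀ x, φ x = c • x) :
    ∃ E : Λ → T → Λ → T → F, ∀ (μ : Λ) (x : T) (a : V) (ν : Λ) (y : T) (b : V),
      polTensor ℝ (expChart ℰ ρ) μ x a ν y b = killingForm ℝ 𝔤 (eV a) (eV b) • E μ x ν y :=
  exists_scalar_kernel_polTensor_expChart eV e ρ hρ hℰ h47 (killingForm ℝ 𝔤)
    (LieModule.traceForm_lieInvariant ℝ 𝔤 𝔤) (LieAlgebra.IsKilling.killingForm_nondegenerate ℝ 𝔤) hcen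

end Chart

/-! ## §6 (v1.1) The Ward identities (4.15)₁ / (5.9) at finite volume for the named object -/

section Ward

variable (𝕜 : Type*) [NontriviallyNormedField 𝕜] [IsRCLikeNormedField 𝕜] {Λ T V F : Type*} [Fintype Λ] [Fintype T]
  [DecidableEq Λ] [DecidableEq T] [AddCommGroup T] [NormedAddCommGroup V] [NormedSpace 𝕜 V] [NormedAddCommGroup F]
  [NormedSpace 𝕜 F]

/-- **(4.15)₁ ⇒ (5.9) at finite volume for (1.20)**: if the Hessian of `𝓔` at `0` kills pure-gauge directions `∂λ`
((4.15)₁ *"⟨(δ²/δB²)𝐄(1), B₁, ∂λ⟩ = 0 … for an arbitrary gauge function λ, and arbitrary gauge fields B₁"*, the lineage's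
hypothesis `h415` with bonds `(y, y + e_ν)`) and `𝓔 ∈ C²`, then `Σ_μ [Π_{μν}(x − e_μ, y) − Π_{μν}(x, y)] = 0` and
`Σ_ν [Π_{μν}(x, y − e_ν) − Π_{μν}(x, y)] = 0` (both colour slots `v`) — print's *"Σ_μ ∂*_μΠ_{μν}(x − y) = Σ_ν ∂_νΠ_{μν}(x − y)
= 0"* (5.9) before the limit; `…B12Ward59.ward415_finiteVolume` for `H := polTensor`.
[cite: Balaban1987RG1, (4.15) p.284 with (5.9) p.293 and (1.20) p.264] -/
theorem ward415_polTensor {𝓔 : (Λ → T → V) → F} (h𝓔 : ContDiff 𝕜 2 𝓔) (e : Λ → T) (v : V)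
    (h415 : ∀ (u : Λ → T → V) (lam : T → V),
      fderiv 𝕜 (fderiv 𝕜 𝓔) 0 u (fun ν y => lam (y + e ν) - lam y) = 0) :
    (∀ ν x y, ∑ μ, (polTensor 𝕜 𝓔 μ (x - e μ) v ν y v - polTensor 𝕜 𝓔 μ x v ν y v) = 0) ∧
      ∀ μ x y, ∑ ν, (polTensor 𝕜 𝓔 μ x v ν (y - e ν) v - polTensor 𝕜 𝓔 μ x v ν y v) = 0 :=
  B12Ward59.ward415_finiteVolume h𝓔 e v h415 (H := fun μ ν x y => polTensor 𝕜 𝓔 μ x v ν y v) fun _ _ _ _ => rfl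

end Ward

section WardChart

variable {𝔄 : Type*} [NormedRing 𝔄] [NormedAlgebra ℝ 𝔄] [CompleteSpace 𝔄] {Λ T F : Type*} [Fintype Λ] [Fintype T]
  [DecidableEq Λ] [DecidableEq T] [AddCommGroup T] [NormedAddCommGroup F] [NormedSpace ℝ F]

omit [CompleteSpace 𝔄] [Fintype Λ] [Fintype T] [DecidableEq Λ] [DecidableEq T] [AddCommGroup T] [NormedAddCommGroup F]
  [NormedSpace ℝ F] in
/-- Print's chart with `𝔄`-valued fields read directly (`V = 𝔄`, `ρ = id`) is the lineage's `B ↦ 𝐄(exp B)` of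
`…B12GaugeInv47` §3. [cite: Balaban1987RG1, p.264 (before (1.20)) with (4.8) p.283] -/
theorem expChart_id (ℰ : (Λ → T → 𝔄) → F) :
    (expChart ℰ (ContinuousLinearMap.id ℝ 𝔄) : (Λ → T → 𝔄) → F) = fun B => ℰ (fun ν x => exp (B ν x)) := rfl

/-- **(4.7) + (4.14) ⇒ (4.15)₁ ⇒ (5.9) AT FINITE VOLUME FOR THE NAMED (1.20) OF PRINT'S CHART**: for `𝐄 ∈ C²`, gauge
invariant near `V = 1` in the lineage's `h47` form ((4.7) p. 282) and with (4.14) `D𝐄(1) = 0`, the tensor (1.20) of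
`B ↦ 𝐄(exp B)` satisfies both slot identities of (5.9) on the torus — the Ward hypothesis `h415` DISCHARGED by
`…B12GaugeInv47.h415_of_gaugeInvariance`. [cite: Balaban1987RG1, (4.7) p.282, (4.14)-(4.15) p.284, (5.9) p.293, (1.20) p.264] -/
theorem ward415_polTensor_expChart {ℰ : (Λ → T → 𝔄) → F} (hℰ : ContDiff ℝ 2 ℰ) (e : Λ → T)
    (h47 : ∀ lam : T → 𝔄, ∀ᶠ W in 𝓝 (1 : Λ → T → 𝔄), ∀ᶠ t in 𝓝 (0 : ℝ),
      ℰ (fun ν x => exp (t • lam x) * W ν x * exp (-(t • lam (x + e ν)))) = ℰ W)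
    (h414 : fderiv ℝ ℰ 1 = 0) (v : 𝔄) :
    (∀ ν x y, ∑ μ, (polTensor ℝ (expChart ℰ (ContinuousLinearMap.id ℝ 𝔄)) μ (x - e μ) v ν y v
        - polTensor ℝ (expChart ℰ (ContinuousLinearMap.id ℝ 𝔄)) μ x v ν y v) = 0) ∧
      ∀ μ x y, ∑ ν, (polTensor ℝ (expChart ℰ (ContinuousLinearMap.id ℝ 𝔄)) μ x v ν (y - e ν) v
        - polTensor ℝ (expChart ℰ (ContinuousLinearMap.id ℝ 𝔄)) μ x v ν y v) = 0 := by
  have hC : ContDiff ℝ 2 (expChart ℰ (ContinuousLinearMap.id ℝ 𝔄) : (Λ → T → 𝔄) → F) :=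
    contDiff_expChart _ hℰ
  have h415 := B12GaugeInv47.h415_of_gaugeInvariance e hℰ.contDiffAt h47 h414
  rw [expChart_id] at hC ⊢
  exact ward415_polTensor ℝ hC e v h415

end WardChart

end Literature.MathematicalPhysics.QuantumFieldTheory.Balaban1983to89.B12PolarizationTensor120
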